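import Literature.NumberTheory.Automorphic.WhittakerTowerBridge
import Literature.NumberTheory.Automorphic.WhittakerTowerCoeff
import Literature.NumberTheory.Automorphic.AutomorphicRepsGLCuspBridgeProofs
import Literature.NumberTheory.Automorphic.SmoothedCuspForms
import Literature.NumberTheory.Automorphic.WhittakerCoeffCuspidal
import HarnessLib

/-!
# Smoothed `L²` cusp forms on `GL_n` are generic: their global Whittaker coefficient is not zero
(Shalika (1974), Thm. 5.9; Piatetski-Shapiro (1979); Cogdell (2004), §1.1, Cor. to Thm. 1.1)

Topic `NumberTheory/Automorphic`; namespace `Literature.NumberTheory.Automorphic`. Proof file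
(theorems only: no definition, no named fact). The tree proves genericity of cusp forms on `GL_n` in
mean square for an abstract continuous, left `GL_n(K)`-invariant `φ` satisfying the cusp conditions
(`eq_zero_of_whittakerDepth_zero_eq_zero` of `WhittakerTowerBridge`, with
`whittakerDepth_zero_eq_whittakerCoeff` of `WhittakerTowerCoeff` identifying the bottom of the tower
with the global Whittaker coefficient `whittakerCoeff` of `GlobalWhittakerCoefficient`). This file
instantiates it for the functions the real-point Rankin–Selberg programme works with
(`RankinSelbergTorusIntegral`, `RankinSelbergTorusPositivity`, `CuspidalTestVector`): the classical
function `φ = invQuot (S_η f)` of a smoothed `L²` cusp form.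

* `invQuot_ratGL_mul` — `invQuot F` is left invariant under the rational points `ratGL K δ`
  (`isLeftInvariant_invQuot`; `ratGL K δ = (gl n K).toAdelic δ`);
* `cuspConditionGL_invQuot_smoothedForm` — `invQuot (S_η f)` satisfies the cusp conditions
  `CuspConditionGL` for `f ∈ L²_cusp` (`isContinuousCuspForm_smoothedForm` through the inversion
  bridge `AutomorphicRepsGL.cuspConditionGL_invQuot_iff_holds`);
* `invQuot_smoothedForm_eq_zero_of_whittakerCoeff_eq_zero`,
  `exists_whittakerCoeff_invQuot_smoothedForm_ne_zero_of_one_le` (**main**; the case `n = 2` is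
  `exists_whittakerCoeff_invQuot_smoothedForm_ne_zero` of `CuspidalWhittakerGL2`): for `1 ≤ n`, `η` a continuous
  compactly supported weight, `f ∈ L²_cusp` with `S_η f ≠ 0`, and any Haar measure `ν₀` on
  `N_n(𝔸_K)`, the Whittaker coefficient `W = whittakerCoeff ν₀ 𝓕_N ψ (invQuot (S_η f))` for Tate's
  character `ψ = adeleAddChar K` and Tate's box `𝓕_N = unipotentTateDomain n K` does not vanish
  identically — the input `W(g₀) ≠ 0` of `exists_torusPoint_apply_ne_zero` /
  `setLIntegral_torusIntegrand_unitBox_ne_zero` (`RankinSelbergTorusPositivity`).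

Measurable structures as in `WhittakerTower*`: Borel structures on `𝔸_K` and on `GL_n(𝔸_K)` as
instance arguments, the unipotent subgroup carrying the subtype structure. Everything is proved.

## References

* J. A. Shalika, *The multiplicity one theorem for GL_n*, Ann. of Math. 100 (1974), §5, Thm. 5.9
  [Shalika1974].
* J. W. Cogdell, *Analytic theory of L-functions for GL_n*, in *An Introduction to the Langlands
  Program* (2004), §1.1, Thm. 1.1 and Corollary [CogdellAnalyticTheory2004].
-/

noncomputable section

open MeasureTheory Measure NumberField IsDedekindDomain Set Filter
open scoped MatrixGroups ENNReal NNReal Topology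

namespace Literature.NumberTheory.Automorphic

section Generic

variable {n : ℕ} {K : Type} [Field K] [NumberField K]
  {μ : Measure (AdelicGroupData.gl n K).automorphicQuotient}
  [(AdelicGroupData.gl n K).IsAutomorphicMeasure μ]

/-- `invQuot F` is left invariant under the rational points `ratGL K δ = (gl n K).toAdelic δ`.
[folklore] -/
theorem invQuot_ratGL_mul (F : (AdelicGroupData.gl n K).automorphicQuotient → ℂ) (δ : GL (Fin n) K)
    (x : GL (Fin n) (AdeleRing (𝓞 K) K)) :
    invQuot (AdelicGroupData.gl n K) F (ratGL K δ * x) = invQuot (AdelicGroupData.gl n K) F x :=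
  isLeftInvariant_invQuot (AdelicGroupData.gl n K) F _ ⟨δ, rfl⟩ x

/-- The classical function `invQuot (S_η f)` of a smoothed `L²` cusp form satisfies the cusp
conditions along every maximal parabolic (`isContinuousCuspForm_smoothedForm` and the inversion
bridge `cuspConditionGL_invQuot_iff_holds`). [folklore] -/
theorem cuspConditionGL_invQuot_smoothedForm {η : (AdelicGroupData.gl n K).Adelic → ℝ}
    (hη : Continuous η) (hηs : HasCompactSupport η) {f : (AdelicGroupData.gl n K).L2 μ}
    (hf : f ∈ cuspidalSubspace n K μ) {k : ℕ} (hk : 0 < k) (hkn : k < n) :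
    CuspConditionGL n K (invQuot (AdelicGroupData.gl n K) (smoothedForm η f)) k :=
  (AutomorphicRepsGL.cuspConditionGL_invQuot_iff_holds n K (smoothedForm η f) k).2
    ((isContinuousCuspForm_smoothedForm hη hηs hf).2.2 k hk hkn)

variable [MeasurableSpace (AdeleRing (𝓞 K) K)] [BorelSpace (AdeleRing (𝓞 K) K)]
variable [MeasurableSpace (GL (Fin n) (AdeleRing (𝓞 K) K))] [BorelSpace (GL (Fin n) (AdeleRing (𝓞 K) K))]

/-- **A smoothed `L²` cusp form with vanishing Whittaker coefficient is zero** (Shalika (1974),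
Thm. 5.9 / Cogdell (2004), Cor. to Thm. 1.1, through the mean-square tower of the tree): for `1 ≤ n`,
a continuous compactly supported weight `η`, `f ∈ L²_cusp`, and a Haar measure `ν₀` on `N_n(𝔸_K)`, if
`whittakerCoeff ν₀ 𝓕_N ψ (invQuot (S_η f))` vanishes identically (Tate's box and character), then
`S_η f = 0`. [cite: Shalika1974, §5 Thm. 5.9] -/
theorem invQuot_smoothedForm_eq_zero_of_whittakerCoeff_eq_zero (hn : 1 ≤ n)
    {η : (AdelicGroupData.gl n K).Adelic → ℝ} (hη : Continuous η) (hηs : HasCompactSupport η)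
    {f : (AdelicGroupData.gl n K).L2 μ} (hf : f ∈ cuspidalSubspace n K μ)
    (ν₀ : Measure ↥(adelicUnipotent n K)) [IsHaarMeasure ν₀]
    (h0 : ∀ g, whittakerCoeff ν₀ (unipotentTateDomain n K) (adeleAddChar K)
      (invQuot (AdelicGroupData.gl n K) (smoothedForm η f)) g = 0) :
    smoothedForm η f = 0 := by
  set φ := invQuot (AdelicGroupData.gl n K) (smoothedForm η f) with hφ
  have hφc : Continuous φ := continuous_invQuot_smoothedForm hη hηs f
  have hinv : ∀ (δ : GL (Fin n) K) (x : GL (Fin n) (AdeleRing (𝓞 K) K)), φ (ratGL K δ * x) = φ x :=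
    fun δ x => invQuot_ratGL_mul _ δ x
  have hcusp : ∀ k, 0 < k → k < n → CuspConditionGL n K φ k := fun k hk hkn =>
    cuspConditionGL_invQuot_smoothedForm hη hηs hf hk hkn
  have hW0 : ∀ x, whittakerDepth 0 φ x = 0 := fun x => by
    rw [whittakerDepth_zero_eq_whittakerCoeff hφc hn ν₀ x]
    exact h0 x
  have hzero := eq_zero_of_whittakerDepth_zero_eq_zero hφc hinv hcusp hW0
  funext y
  obtain ⟨g, rfl⟩ := QuotientGroup.mk_surjective y
  have h : φ (g⁻¹ : (AdelicGroupData.gl n K).Adelic) = 0 := hzero _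
  rw [hφ, invQuot_apply, inv_inv] at h
  exact h

/-- **Smoothed `L²` cusp forms are generic**: for `1 ≤ n`, a continuous compactly supported weight
`η` and `f ∈ L²_cusp` with `S_η f ≠ 0`, the global Whittaker coefficient of `invQuot (S_η f)` (any
Haar measure `ν₀` on `N_n(𝔸_K)`, Tate's box and character) is non-zero somewhere — the `W(g₀) ≠ 0`
of `RankinSelbergTorusPositivity.exists_torusPoint_apply_ne_zero`. [cite: Shalika1974, §5 Thm. 5.9] -/
theorem exists_whittakerCoeff_invQuot_smoothedForm_ne_zero_of_one_le (hn : 1 ≤ n)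
    {η : (AdelicGroupData.gl n K).Adelic → ℝ} (hη : Continuous η) (hηs : HasCompactSupport η)
    {f : (AdelicGroupData.gl n K).L2 μ} (hf : f ∈ cuspidalSubspace n K μ)
    (hne : smoothedForm η f ≠ 0) (ν₀ : Measure ↥(adelicUnipotent n K)) [IsHaarMeasure ν₀] :
    ∃ g, whittakerCoeff ν₀ (unipotentTateDomain n K) (adeleAddChar K)
      (invQuot (AdelicGroupData.gl n K) (smoothedForm η f)) g ≠ 0 := by
  by_contra h
  exact hne (invQuot_smoothedForm_eq_zero_of_whittakerCoeff_eq_zero hn hη hηs hf ν₀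
    fun g => not_not.1 (not_exists.1 h g))

end Generic

end Literature.NumberTheory.Automorphic
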